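import Mathlib.Data.ZMod.Basic
import Literature.MathematicalPhysics.StatisticalMechanics.Theil2006
import HarnessLib

/-!
# Theil 2006, Theorem 1.2 as printed: the lattice energy, the `Σ7` coincidence rotation, and why
the translation-only conclusion is degenerate

Topic `Literature/MathematicalPhysics/StatisticalMechanics`; companion of `Theil2006.lean`, which
vendors F. Theil, *A proof of crystallization in two dimensions*, Comm. Math. Phys. **262** (2006)
209–236, and in particular its Theorem 1.2 (ground states with periodic boundary conditions)
verbatim as the named fact `Theil2006_periodicGroundStates`: "… for every ground state
`y_min : A₂ → ℝ²` of `E_L^per` subject to `y ∈ Y_L^per` there exists a **translation vector**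
`τ ∈ ℝ²` such that `{y_min(x) + τ | x ∈ A₂} = A₂`." Everything in this file is PROVED (no
`sorry`) except the ONE named fact `Theil2006_periodicGroundStates_upToRotation` at the end —
Theorem 1.2 with the conclusion its printed proof actually establishes (a rigid motion of `A₂`),
vendored after the primary source was read (2026-08-23, see *The corrected statement* below); the
rest records that the printed translation-only conclusion is degenerate. Outcome of the `provefact`
unit for `Theil2006_periodicGroundStates`: **misstated** (corrected as
`Theil2006_periodicGroundStates_upToRotation`).

## What is proved

* `Theil2006.periodicEnergy_triPoint`: `E_L^per(A₂) = L² ∑_{ξ ∈ A₂∖{0}} V(|ξ|)` for every `V` and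
  `L` (each of the `L²` particles of a period cell sees every lattice distance exactly once), hence
  `= -6 L²` for a normalized `V` (`IsNormalized.periodicEnergy_triPoint`).
* **The `Σ7` competitor** (`Theil2006.rotated7`, `exists_isPeriodic_seven_rotated`). Let
  `γ = 8 b₁ - 3 b₂ ∈ A₂ = ℤ[b₂]` (`b₂² = b₂ - 1`), `|γ|² = 8² - 8·3 + 3² = 49`, and `u = γ / 7`:
  `|u| = 1`, `arg u = -arccos(13/14) ≈ -21.8°`, `u ∉ A₂`. With `β = 5 b₁ + 3 b₂` one has `γ β = 49`,
  so `u (β ξ) = 7 ξ` and **`u A₂ ⊇ 7 A₂`**: `u A₂` is the `Σ7` coincidence-site lattice of the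
  hexagonal lattice. An explicit `7A₂`-equivariant relabelling `φ : ℤ² ≃ ℤ²`,
  `φ(k + 7g) = φ(k) + β g` (`sigma7Equiv`; on the period cell `c ↦ (c₁ + 7 c₂)·(3,2)`, a system of
  representatives of `ℤ²/βℤ² ≅ ℤ/49`), gives `y = u ∘ φ ∈ Y_7^per` (`isPeriodic_rotated7`), a
  bijection of `A₂` onto `u A₂`, with `E_7^per(y) = E_7^per(A₂)` for EVERY potential `V`
  (`periodicEnergy_rotated7`: each particle sees the distances `|u ξ| = |ξ|`, `ξ ≠ 0`, once), whose
  image is not a translate of `A₂` (`range_rotated7_add_ne`: it contains `0` and `u b₁ ∉ A₂`).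
* `Theil2006.injective_of_equivariant_surjective`: an `Lℤ²`-equivariant surjection `ℤ² → ℤ²` is
  injective (finite quotient `(ℤ/L)²`); hence a configuration `y ∈ Y_L^per` whose image is a
  translate of `A₂` is a bijection onto it and has the energy of `A₂`
  (`IsPeriodic.periodicEnergy_eq_of_range_eq`).
* **Degeneracy** (`Theil2006_periodicGroundStates.no_groundState_seven`): under the printed fact,
  for every `α` below its threshold and every admissible `V`, `E_7^per` has NO ground state in
  `Y_7^per` at all — a ground state would have the energy of `A₂`, hence of the `Σ7` competitor,
  which would then be a ground state violating the conclusion. In particular `A₂` itself is never a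
  ground state of `E_7^per` and is strictly beaten by some `y' ∈ Y_7^per`
  (`Theil2006_periodicGroundStates.exists_lt_lattice`). So at `L = 7` (and at every `L` with a prime
  factor `≡ 1 (mod 3)`, where `L²` is a non-trivial value of the norm form `m² + mn + n²` and a
  coincidence rotation exists) the printed Theorem 1.2 can only hold vacuously, which contradicts
  the optimality of `A₂` that the theorem is about; refuting the fact outright in Lean would need
  the crystallization lower bound itself and is not attempted here.

## The corrected statement (vendored here: `Theil2006_periodicGroundStates_upToRotation`)

**What the printed proof establishes** (primary source read 2026-08-23: the author's accepted
preprint of 26 Aug 2005, `homepages.warwick.ac.uk/~masfk/Crystallization.pdf` via web.archive.org,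
lit store `paper:url-69bff4ce1e30`, numbering identical with the journal version). §3, p. 13:
"It can be shown with elementary methods that every nonempty set `Ω ⊂ ℝ²` with the properties
(42) `min_{y,y' ∈ Ω, y ≠ y'} |y - y'| ≥ 1` and (43) `#{y' ∈ Ω | |y - y'| ≤ 1} = 7` for all `y ∈ Ω` is
countable and there exists a rotation `R ∈ SO(2)` and a translation `τ ∈ ℝ²` such that
`RΩ + τ = A₂`." §3, Proof of Theorem 1.2, p. 14: "Since `#X̃ ≤ L²` this estimate shows that
`#X̃_min = L²`, `∂X̃_min = ∅`, and `|y_min(x) - y_min(x')| = 1` for all `{x,x'} ∈ 𝒮`. Hence, the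
set `Ω = {y_min(x) | x ∈ A₂}` satisfies (42) and (43) and consequentially `RΩ + τ = A₂` for a
rotation `R ∈ SO(2)` and a translation `τ ∈ ℝ²`. By the periodicity of `y_min` we can choose
`R = Id`, this is precisely the claim and the proof of Theorem 1.2 is finished." The last sentence
is the faulty step: periodicity (`Ω + L A₂ = Ω`) only forces `L · R⁻¹ A₂ ⊆ A₂`, which holds for
`R ∉ D₆` exactly when `L` has a prime factor `p ≡ 1 (mod 3)` (`p = π π̄` in `ℤ[b₂]`, `R⁻¹ = π/π̄ ·`;
`L = 7` above). So the theorem the paper PROVES is Theorem 1.2 with the conclusion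
"`RΩ + τ = A₂` for a rotation `R` and a translation `τ`" — the form in which the same author
states the three-dimensional analogue (Flatley–Theil, ARMA **218** (2015), §1 Corollary 1.3:
"there exists a translation vector `t ∈ ℝ³` and a rotation `R ∈ SO(3)` such that
`R Z + t = Λ_fcc`", bib key `FlatleyTheil2015`). It is vendored at the end of this file as the
named fact `Theil2006_periodicGroundStates_upToRotation`, with the hypotheses of
`Theil2006_periodicGroundStates` unchanged and the conclusion

  `∃ (R : Plane ≃ₗᵢ[ℝ] Plane) (τ : Plane), Set.range (fun k => R (y k) + τ) = triangularLattice`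

(`R` a linear isometry, i.e. `O(2) ⊇ SO(2)`: formally weaker than the source and equivalent to it,
`A₂` being invariant under the reflection `b₂ ↦ b₁ - b₂`). Two proved sanity links:
`Theil2006_periodicGroundStates.upToRotation` (the printed form implies it, `R = 1`) and
`Theil2006.exists_rotation_range_rotated7` (the `Σ7` competitor SATISFIES the corrected
conclusion — `R (u A₂) = A₂` for the rotation `R = ū ·`, `Theil2006.rot7Inv` — so the `L = 7`
degeneracy argument above does not apply to it). `Theil2006_periodicGroundStates` itself keeps its
printed meaning and should not be fed to new routes; Corollary 1.3 (`Theil2006_dirichletGroundStates`)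
is unaffected (there `y = x` off the finite set `𝒜`, which forces `R ∈ D₆`, p. 15).
-/

noncomputable section

open scoped BigOperators Topology
open Filter Set

namespace Literature.MathematicalPhysics.StatisticalMechanics

namespace Theil2006

/-- Reindexing the inner sum of `E_L^per`: if the distances from `y c` to the other particles
run through the lattice distances `|ξ|`, `ξ ∈ A₂ ∖ {0}`, each exactly once (along a bijection of
labels `e` with `e c = 0`), then the inner sum is the lattice sum (1) at `r = 1`. [folklore] -/
theorem tsum_eq_latticeSum_of_equiv (V : ℝ → ℝ) {y : ℤ × ℤ → Plane} {c : ℤ × ℤ}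
    (e : ℤ × ℤ ≃ ℤ × ℤ) (he : e c = 0) (hy : ∀ k', dist (y c) (y k') = ‖triPoint (e k')‖) :
    ∑' k' : {k' : ℤ × ℤ // k' ≠ c}, V (dist (y c) (y k'.1)) = latticeSum V 1 := by
  have hiff : ∀ k', k' ≠ c ↔ e k' ≠ 0 := fun k' => by rw [← he, e.injective.ne_iff]
  rw [latticeSum, ← Equiv.tsum_eq (e.subtypeEquiv hiff) fun k => V (1 * ‖triPoint k.1‖)]
  refine tsum_congr fun k' => ?_
  rw [hy, one_mul]
  rfl

/-- **Energy of the undeformed lattice.** `E_L^per(A₂) = L² ∑_{ξ ∈ A₂∖{0}} V(|ξ|)`: each of the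
`L²` particles of a period cell sees every lattice distance exactly once. [cite: Theil2006, §1 (1)] -/
theorem periodicEnergy_triPoint (V : ℝ → ℝ) (L : ℕ) :
    periodicEnergy V L triPoint = (L : ℝ) ^ 2 * latticeSum V 1 := by
  have h : ∀ k : Fin L × Fin L, ∑' k' : {k' : ℤ × ℤ // k' ≠ cellPoint k},
      V (dist (triPoint (cellPoint k)) (triPoint k'.1)) = latticeSum V 1 := fun k =>
    tsum_eq_latticeSum_of_equiv V (Equiv.subLeft (cellPoint k)) (sub_self _) fun k' => by
      rw [Equiv.subLeft_apply, dist_eq_norm, map_sub]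
  simp only [periodicEnergy, h, Finset.sum_const, Finset.card_univ, Fintype.card_prod,
    Fintype.card_fin, nsmul_eq_mul, Nat.cast_mul, sq]

/-- For a normalized potential the undeformed lattice has periodic energy `-6 L²`.
[cite: Theil2006, §1 (1)] -/
theorem IsNormalized.periodicEnergy_triPoint {V : ℝ → ℝ} (hV : IsNormalized V) (L : ℕ) :
    periodicEnergy V L triPoint = -6 * (L : ℝ) ^ 2 := by
  rw [Theil2006.periodicEnergy_triPoint, hV.latticeSum_one]; ring

/-! ### The `Σ7` coincidence rotation -/

/-- Multiplication by the Eisenstein integer `γ = 8 b₁ - 3 b₂` of norm `|γ|² = 8² - 8·3 + 3² = 49`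
on labels: `γ · (m b₁ + n b₂) = (8m + 3n) b₁ + (5n - 3m) b₂` (using `b₂² = b₂ - 1`). [folklore] -/
def sigma7Mul (k : ℤ × ℤ) : ℤ × ℤ := (8 * k.1 + 3 * k.2, -3 * k.1 + 5 * k.2)

/-- The rotation `ξ ↦ u ξ` of `A₂` by `u = γ / 7`, `|u| = 1`, `arg u = -arccos (13/14) ≈ -21.8°`
(not a multiple of `60°`), on labels. Its image `u A₂` contains `7 A₂` (`sigma7Mul_beta`): the
`Σ7` coincidence-site lattice of the hexagonal lattice. [folklore] -/
def rot7 (k : ℤ × ℤ) : Plane := (7 : ℝ)⁻¹ • triPoint (sigma7Mul k)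

/-- `γ (a - b) = γ a - γ b` on labels. [folklore] -/
theorem sigma7Mul_sub (a b : ℤ × ℤ) : sigma7Mul (a - b) = sigma7Mul a - sigma7Mul b := by
  ext <;> simp only [sigma7Mul, Prod.fst_sub, Prod.snd_sub] <;> ring

/-- `u` is additive on labels: `u a - u b = u (a - b)`. [folklore] -/
theorem rot7_sub (a b : ℤ × ℤ) : rot7 a - rot7 b = rot7 (a - b) := by
  rw [rot7, rot7, rot7, sigma7Mul_sub, map_sub, smul_sub]

/-- `u` is a rotation: `|u ξ| = |ξ|` (the norm form is multiplied by `|γ|² = 49`). [folklore] -/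
theorem norm_rot7 (k : ℤ × ℤ) : ‖rot7 k‖ = ‖triPoint k‖ := by
  have h : ‖triPoint (sigma7Mul k)‖ = 7 * ‖triPoint k‖ := by
    rw [← sq_eq_sq₀ (norm_nonneg _) (by positivity), mul_pow, norm_triPoint_sq, norm_triPoint_sq]
    simp only [sigma7Mul]
    push_cast
    ring
  rw [rot7, norm_smul, norm_inv, Real.norm_eq_abs, abs_of_pos (by norm_num : (0 : ℝ) < 7), h]
  ring

/-- `γ β = 49` for `β = 5 b₁ + 3 b₂` (`= 7² / γ`): in labels, `sigma7Mul (β · g) = 49 g`, so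
`u · (β ξ) = 7 ξ` and `7 A₂ ⊂ u A₂`. [folklore] -/
theorem sigma7Mul_beta (g : ℤ × ℤ) :
    sigma7Mul (5 * g.1 - 3 * g.2, 3 * g.1 + 8 * g.2) = (49 * g.1, 49 * g.2) := by
  ext <;> simp only [sigma7Mul] <;> ring

/-- An explicit bijection of labels `φ : ℤ² ≃ ℤ²` with `φ (k + 7 g) = φ k + β g`
(`sigma7Equiv_add_zsmul`): on the period cell `c = (c₁, c₂) ∈ [0,7)²` it is `c ↦ (c₁ + 7 c₂) · (3, 2)`,
a system of representatives of `ℤ² / β ℤ² ≅ ℤ/49`. [folklore] -/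
def sigma7Equiv : ℤ × ℤ ≃ ℤ × ℤ where
  toFun k := (5 * (k.1 / 7) - 3 * (k.2 / 7) + 3 * (k.1 % 7 + 7 * (k.2 % 7)),
    3 * (k.1 / 7) + 8 * (k.2 / 7) + 2 * (k.1 % 7 + 7 * (k.2 % 7)))
  invFun p :=
    (((-3 * p.1 + 5 * p.2) % 49) % 7 + 7 * (2 * p.1 - 3 * p.2 + 30 * ((-3 * p.1 + 5 * p.2) / 49)),
      ((-3 * p.1 + 5 * p.2) % 49) / 7 + 7 * ((-3 * p.1 + 5 * p.2) / 49))
  left_inv k := by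
    obtain ⟨a, b⟩ := k
    simp only [Prod.mk.injEq]
    constructor <;> omega
  right_inv p := by
    obtain ⟨p, q⟩ := p
    simp only [Prod.mk.injEq]
    have h1 := Int.emod_add_mul_ediv (-3 * p + 5 * q) 49
    have h2 := Int.emod_nonneg (-3 * p + 5 * q) (by norm_num : (49 : ℤ) ≠ 0)
    have h3 := Int.emod_lt_of_pos (-3 * p + 5 * q) (by norm_num : (0 : ℤ) < 49)
    generalize (-3 * p + 5 * q) % 49 = i at h1 h2 h3 ⊢
    generalize (-3 * p + 5 * q) / 49 = g at h1 ⊢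
    have h4 := Int.emod_add_mul_ediv i 7
    have h5 := Int.emod_nonneg i (by norm_num : (7 : ℤ) ≠ 0)
    have h6 := Int.emod_lt_of_pos i (by norm_num : (0 : ℤ) < 7)
    generalize i % 7 = c₁ at h4 h5 h6 ⊢
    generalize i / 7 = c₂ at h4 ⊢
    have e1 : (c₁ + 7 * (2 * p - 3 * q + 30 * g)) / 7 = 2 * p - 3 * q + 30 * g := by omega
    have e2 : (c₁ + 7 * (2 * p - 3 * q + 30 * g)) % 7 = c₁ := by omega
    have e3 : (c₂ + 7 * g) / 7 = g := by omega
    have e4 : (c₂ + 7 * g) % 7 = c₂ := by omega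
    constructor <;> omega

/-- `7A₂`-equivariance of the relabelling: `φ (k + 7 g) = φ k + β g`, `β = 5 b₁ + 3 b₂ = 7²/γ`.
[folklore] -/
theorem sigma7Equiv_add_zsmul (k g : ℤ × ℤ) :
    sigma7Equiv (k + (7 : ℤ) • g) = sigma7Equiv k + (5 * g.1 - 3 * g.2, 3 * g.1 + 8 * g.2) := by
  obtain ⟨a, b⟩ := k
  obtain ⟨g₁, g₂⟩ := g
  simp only [sigma7Equiv, Equiv.coe_fn_mk, Prod.smul_mk, smul_eq_mul, Prod.mk_add_mk,
    Prod.mk.injEq]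
  constructor <;> omega

/-- **The `Σ7` competitor**: the `7A₂`-equivariant bijection `A₂ → u A₂`, `x ↦ u φ(x)`, onto the
rotated lattice `u A₂ ⊋ 7 A₂`. [folklore] -/
def rotated7 (k : ℤ × ℤ) : Plane := rot7 (sigma7Equiv k)

/-- The `Σ7` competitor satisfies the periodic constraint `y ∈ Y_7^per`. [folklore] -/
theorem isPeriodic_rotated7 : IsPeriodic 7 rotated7 := by
  intro k g
  simp only [rotated7, Nat.cast_ofNat]
  rw [sigma7Equiv_add_zsmul]
  generalize sigma7Equiv k = p
  ext i
  fin_cases i <;> simp [rot7, sigma7Mul, triPoint_apply_zero, triPoint_apply_one] <;> ring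

/-- The `Σ7` competitor has the periodic energy of the undeformed lattice, for every potential:
each particle sees the distances `|u ξ| = |ξ|`, `ξ ∈ A₂ ∖ {0}`, each once. [folklore] -/
theorem periodicEnergy_rotated7 (V : ℝ → ℝ) :
    periodicEnergy V 7 rotated7 = periodicEnergy V 7 triPoint := by
  rw [periodicEnergy_triPoint]
  have h : ∀ k : Fin 7 × Fin 7, ∑' k' : {k' : ℤ × ℤ // k' ≠ cellPoint k},
      V (dist (rotated7 (cellPoint k)) (rotated7 k'.1)) = latticeSum V 1 := fun k =>
    tsum_eq_latticeSum_of_equiv V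
      (sigma7Equiv.trans (Equiv.subLeft (sigma7Equiv (cellPoint k)))) (by simp) fun k' => by
        rw [Equiv.trans_apply, Equiv.subLeft_apply, dist_eq_norm, rotated7, rotated7, rot7_sub,
          norm_rot7]
  simp only [periodicEnergy, h, Finset.sum_const, Finset.card_univ, Fintype.card_prod,
    Fintype.card_fin, nsmul_eq_mul, Nat.cast_mul, sq, Nat.cast_ofNat]

/-- The image `u A₂` of the `Σ7` competitor is not a translate of `A₂`: it contains `0` and
`u b₁ = (8 b₁ - 3 b₂)/7 ∉ A₂`. [folklore] -/
theorem range_rotated7_add_ne (τ : Plane) :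
    Set.range (fun k => rotated7 k + τ) ≠ triangularLattice := by
  intro h
  have ha : rotated7 (sigma7Equiv.symm 0) + τ ∈ triangularLattice := by
    rw [← h]; exact ⟨sigma7Equiv.symm 0, rfl⟩
  have hb : rotated7 (sigma7Equiv.symm (1, 0)) + τ ∈ triangularLattice := by
    rw [← h]; exact ⟨sigma7Equiv.symm (1, 0), rfl⟩
  obtain ⟨a, ha⟩ := ha
  obtain ⟨b, hb⟩ := hb
  simp only [rotated7, Equiv.apply_symm_apply] at ha hb
  have key : triPoint b - triPoint a = rot7 (1, 0) - rot7 0 := by rw [ha, hb]; abel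
  have key0 := congrArg (fun v : Plane => v 0) key
  simp only [PiLp.sub_apply, triPoint_apply_zero, rot7, sigma7Mul, PiLp.smul_apply,
    smul_eq_mul, Prod.fst_zero, Prod.snd_zero, mul_zero, add_zero, Int.cast_zero, zero_div,
    mul_one, Int.cast_ofNat, Int.cast_neg] at key0
  have hz : ((14 * (b.1 - a.1) + 7 * (b.2 - a.2) - 13 : ℤ) : ℝ) = 0 := by
    push_cast
    linear_combination 14 * key0
  norm_cast at hz
  omega

/-- **The `Σ7` competitor, assembled.** There is a configuration `y ∈ Y_7^per` with
`E_7^per(y) = E_7^per(A₂)` for every potential `V` whose image `u A₂` is not a translate of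
`A₂`. [folklore] -/
theorem exists_isPeriodic_seven_rotated :
    ∃ y : ℤ × ℤ → Plane, IsPeriodic 7 y ∧
      (∀ V : ℝ → ℝ, periodicEnergy V 7 y = periodicEnergy V 7 triPoint) ∧
        ∀ τ : Plane, Set.range (fun k => y k + τ) ≠ triangularLattice :=
  ⟨rotated7, isPeriodic_rotated7, periodicEnergy_rotated7, range_rotated7_add_ne⟩

/-! ### Periodic configurations onto `A₂` -/

/-- An `L ℤ²`-equivariant surjection `ℤ² → ℤ²` (`L ≥ 1`) is injective: it induces a surjection,
hence a bijection, of the finite quotient `(ℤ/L)²`. [folklore] -/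
theorem injective_of_equivariant_surjective {L : ℕ} (hL : 0 < L) {f : ℤ × ℤ → ℤ × ℤ}
    (hf : ∀ k g, f (k + (L : ℤ) • g) = f k + (L : ℤ) • g) (hs : Function.Surjective f) :
    Function.Injective f := by
  haveI : NeZero L := ⟨hL.ne'⟩
  let π : ℤ × ℤ → ZMod L × ZMod L := fun k => ((k.1 : ZMod L), (k.2 : ZMod L))
  let s : ZMod L × ZMod L → ℤ × ℤ := fun a => ((a.1.val : ℤ), (a.2.val : ℤ))
  have hπs : ∀ a, π (s a) = a := fun a => by simp [π, s]
  have hsπ : ∀ k, ∃ g, k = s (π k) + (L : ℤ) • g := fun k => by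
    refine ⟨(k.1 / L, k.2 / L), ?_⟩
    ext
    · simp only [π, s, ZMod.val_intCast, Prod.fst_add, Prod.smul_fst, smul_eq_mul]
      exact (Int.emod_add_mul_ediv _ _).symm
    · simp only [π, s, ZMod.val_intCast, Prod.snd_add, Prod.smul_snd, smul_eq_mul]
      exact (Int.emod_add_mul_ediv _ _).symm
  have hker : ∀ k k', π k = π k' → ∃ g, k' = k + (L : ℤ) • g := by
    intro k k' h
    simp only [π, Prod.mk.injEq, ZMod.intCast_eq_intCast_iff_dvd_sub] at h
    obtain ⟨⟨g₁, hg₁⟩, ⟨g₂, hg₂⟩⟩ := h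
    refine ⟨(g₁, g₂), ?_⟩
    ext
    · simp only [Prod.fst_add, Prod.smul_fst, smul_eq_mul]; omega
    · simp only [Prod.snd_add, Prod.smul_snd, smul_eq_mul]; omega
  have hπL : ∀ k g, π (k + (L : ℤ) • g) = π k := fun k g => by
    ext
    · simp only [π, Prod.fst_add, Prod.smul_fst, smul_eq_mul, Int.cast_add, Int.cast_mul,
        Int.cast_natCast, ZMod.natCast_self, zero_mul, add_zero]
    · simp only [π, Prod.snd_add, Prod.smul_snd, smul_eq_mul, Int.cast_add, Int.cast_mul,
        Int.cast_natCast, ZMod.natCast_self, zero_mul, add_zero]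
  let F : ZMod L × ZMod L → ZMod L × ZMod L := fun a => π (f (s a))
  have hFπ : ∀ k, F (π k) = π (f k) := fun k => by
    obtain ⟨g, hg⟩ := hsπ k
    show π (f (s (π k))) = π (f k)
    conv_rhs => rw [hg, hf, hπL]
  have hFs : Function.Surjective F := fun b => by
    obtain ⟨k, hk⟩ := hs (s b)
    exact ⟨π k, by rw [hFπ, hk, hπs]⟩
  have hFi : Function.Injective F := Finite.injective_iff_surjective.mpr hFs
  intro k k' hkk'
  have h1 : π k = π k' := hFi (by rw [hFπ, hFπ, hkk'])
  obtain ⟨g, rfl⟩ := hker k k' h1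
  rw [hf] at hkk'
  have hg : (L : ℤ) • g = 0 := left_eq_add.mp hkk'
  have hL' : (L : ℤ) ≠ 0 := by exact_mod_cast hL.ne'
  have : g = 0 := by
    ext
    · have := congrArg Prod.fst hg
      simp only [Prod.smul_fst, smul_eq_mul, Prod.fst_zero, mul_eq_zero] at this
      exact this.resolve_left hL'
    · have := congrArg Prod.snd hg
      simp only [Prod.smul_snd, smul_eq_mul, Prod.snd_zero, mul_eq_zero] at this
      exact this.resolve_left hL'
  rw [this, smul_zero, add_zero]

/-- A configuration `y ∈ Y_L^per` whose image is a translate of `A₂` (the conclusion of the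
printed Theorem 1.2) is a *bijection* onto that translate, so it has the periodic energy of the
undeformed lattice. [folklore] -/
theorem IsPeriodic.periodicEnergy_eq_of_range_eq {L : ℕ} (hL : 0 < L) {y : ℤ × ℤ → Plane}
    (hy : IsPeriodic L y) {τ : Plane} (hτ : Set.range (fun k => y k + τ) = triangularLattice)
    (V : ℝ → ℝ) : periodicEnergy V L y = periodicEnergy V L triPoint := by
  have hmem : ∀ k, y k + τ ∈ triangularLattice := fun k => hτ ▸ ⟨k, rfl⟩
  choose ι hι using hmem
  have hιper : ∀ k g, ι (k + (L : ℤ) • g) = ι k + (L : ℤ) • g := fun k g =>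
    triPoint_injective (by rw [hι, map_add, hι, hy k g]; abel)
  have hιsurj : Function.Surjective ι := fun a => by
    obtain ⟨k, hk⟩ : triPoint a ∈ Set.range fun k => y k + τ := hτ ▸ ⟨a, rfl⟩
    exact ⟨k, triPoint_injective (by rw [hι, ← hk])⟩
  have hιinj : Function.Injective ι := injective_of_equivariant_surjective hL hιper hιsurj
  let e : ℤ × ℤ ≃ ℤ × ℤ := Equiv.ofBijective ι ⟨hιinj, hιsurj⟩
  rw [periodicEnergy_triPoint]
  have h : ∀ k : Fin L × Fin L, ∑' k' : {k' : ℤ × ℤ // k' ≠ cellPoint k},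
      V (dist (y (cellPoint k)) (y k'.1)) = latticeSum V 1 := fun k =>
    tsum_eq_latticeSum_of_equiv V (e.trans (Equiv.subLeft (ι (cellPoint k)))) (by simp [e])
      fun k' => by
        rw [Equiv.trans_apply, Equiv.subLeft_apply, Equiv.ofBijective_apply, map_sub, hι, hι,
          dist_eq_norm, add_sub_add_right_eq_sub]
  simp only [periodicEnergy, h, Finset.sum_const, Finset.card_univ, Fintype.card_prod,
    Fintype.card_fin, nsmul_eq_mul, Nat.cast_mul, sq]

end Theil2006

open Theil2006

/-- **Theorem 1.2 as printed is degenerate at `L = 7`.** Under `Theil2006_periodicGroundStates`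
(conclusion: a *translate* of `A₂`), for every `α` below its threshold and every admissible `V`
the periodic energy `E_7^per` has **no ground state at all**: a ground state `y` would be a
bijection onto a translate of `A₂` (`IsPeriodic.periodicEnergy_eq_of_range_eq`), hence have the
energy of `A₂`, hence of the `Σ7` competitor (`periodicEnergy_rotated7`), which would then be a
ground state whose image `u A₂` is not a translate of `A₂` (`range_rotated7_add_ne`). So the
printed statement can only hold vacuously for such `L`; the intended conclusion is "up to a
rigid motion" (see the module docstring, *Wording risks*). [folklore] -/
theorem Theil2006_periodicGroundStates.no_groundState_seven (h : Theil2006_periodicGroundStates) :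
    ∃ α₀ : ℝ, 0 < α₀ ∧ ∀ α : ℝ, 0 < α → α < α₀ → ∀ V : ℝ → ℝ, IsAdmissible α V →
      ∀ y : ℤ × ℤ → Plane, IsPeriodic 7 y →
        ¬ ∀ y' : ℤ × ℤ → Plane, IsPeriodic 7 y' → periodicEnergy V 7 y ≤ periodicEnergy V 7 y' := by
  obtain ⟨α₀, hα₀, -, hmain⟩ := h
  refine ⟨α₀, hα₀, fun α hα hα' V hV y hy hmin => ?_⟩
  obtain ⟨τ, hτ⟩ := hmain α hα hα' 7 (by norm_num) V hV y hy hmin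
  have hE : periodicEnergy V 7 y = periodicEnergy V 7 rotated7 := by
    rw [hy.periodicEnergy_eq_of_range_eq (by norm_num) hτ, periodicEnergy_rotated7]
  have hmin' : ∀ y', IsPeriodic 7 y' → periodicEnergy V 7 rotated7 ≤ periodicEnergy V 7 y' :=
    fun y' hy' => hE ▸ hmin y' hy'
  obtain ⟨τ', hτ'⟩ := hmain α hα hα' 7 (by norm_num) V hV rotated7 isPeriodic_rotated7 hmin'
  exact range_rotated7_add_ne τ' hτ'

/-- In particular, under the printed Theorem 1.2 the triangular lattice itself is never a ground
state of `E_7^per`: some `y' ∈ Y_7^per` has energy strictly below `E_7^per(A₂) = -6 · 7²`.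
[folklore] -/
theorem Theil2006_periodicGroundStates.exists_lt_lattice (h : Theil2006_periodicGroundStates) :
    ∃ α₀ : ℝ, 0 < α₀ ∧ ∀ α : ℝ, 0 < α → α < α₀ → ∀ V : ℝ → ℝ, IsAdmissible α V →
      ∃ y' : ℤ × ℤ → Plane, IsPeriodic 7 y' ∧ periodicEnergy V 7 y' < -6 * 7 ^ 2 := by
  obtain ⟨α₀, hα₀, hmain⟩ := h.no_groundState_seven
  refine ⟨α₀, hα₀, fun α hα hα' V hV => ?_⟩
  have := hmain α hα hα' V hV triPoint (isPeriodic_triPoint 7)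
  simp only [not_forall, not_le, exists_prop] at this
  obtain ⟨y', hy', hlt⟩ := this
  refine ⟨y', hy', ?_⟩
  rw [hV.periodicEnergy_triPoint] at hlt
  exact_mod_cast hlt

/-! ### Theorem 1.2 with the conclusion its proof establishes: ground states are rigid motions of `A₂`

Source read for this section: the accepted preprint of 26 Aug 2005 (see the module docstring,
*The corrected statement*), §3, Proof of Theorem 1.2, p. 14 — "`RΩ + τ = A₂` for a rotation
`R ∈ SO(2)` and a translation `τ ∈ ℝ²`. By the periodicity of `y_min` we can choose `R = Id`" —
of which only the first sentence survives the coincidence rotations. First the sanity check that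
the `Σ7` competitor of this file is compatible with the rotation form. -/

namespace Theil2006

/-- Multiplication by the unit complex number `ū = 13/14 + (3√3/14) i` on `ℝ² ≅ ℂ`, i.e. the
rotation inverse to `ξ ↦ u ξ` (`u = γ/7`, `γ = 8 b₁ - 3 b₂ = 13/2 - (3√3/2) i`), as a linear map.
[folklore] -/
def rot7InvLin : Plane →ₗ[ℝ] Plane where
  toFun v := !₂[13 / 14 * v 0 - 3 * √3 / 14 * v 1, 3 * √3 / 14 * v 0 + 13 / 14 * v 1]
  map_add' v w := by
    ext i; fin_cases i <;> simp <;> ring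
  map_smul' c v := by
    ext i; fin_cases i <;> simp <;> ring

/-- First coordinate of `ū v` (private plumbing). [folklore] -/
@[simp] private theorem rot7InvLin_apply_zero (v : Plane) :
    rot7InvLin v 0 = 13 / 14 * v 0 - 3 * √3 / 14 * v 1 := by
  simp [rot7InvLin]

/-- Second coordinate of `ū v` (private plumbing). [folklore] -/
@[simp] private theorem rot7InvLin_apply_one (v : Plane) :
    rot7InvLin v 1 = 3 * √3 / 14 * v 0 + 13 / 14 * v 1 := by
  simp [rot7InvLin]

/-- `|ū| = 1`: the map preserves norms (`(13/14)² + (3√3/14)² = (169 + 27)/196 = 1`; private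
plumbing). [folklore] -/
private theorem norm_rot7InvLin (v : Plane) : ‖rot7InvLin v‖ = ‖v‖ := by
  have h3 : (√3 : ℝ) ^ 2 = 3 := Real.sq_sqrt (by norm_num)
  have key : ‖rot7InvLin v‖ ^ 2 = ‖v‖ ^ 2 := by
    rw [EuclideanSpace.norm_sq_eq, EuclideanSpace.norm_sq_eq, Fin.sum_univ_two, Fin.sum_univ_two,
      Real.norm_eq_abs, Real.norm_eq_abs, Real.norm_eq_abs, Real.norm_eq_abs, sq_abs, sq_abs,
      sq_abs, sq_abs, rot7InvLin_apply_zero, rot7InvLin_apply_one]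
    linear_combination (9 / 196 * (v 0) ^ 2 + 9 / 196 * (v 1) ^ 2) * h3
  have h1 := norm_nonneg (rot7InvLin v)
  have h2 := norm_nonneg v
  nlinarith [key]

/-- The rotation `R = ū ·` of `ℝ²` undoing the `Σ7` coincidence rotation `u ·`, as a linear
isometry equivalence (an element of `SO(2)`: `det = (13/14)² + (3√3/14)² = 1`). [folklore] -/
def rot7Inv : Plane ≃ₗᵢ[ℝ] Plane :=
  (⟨rot7InvLin, norm_rot7InvLin⟩ : Plane →ₗᵢ[ℝ] Plane).toLinearIsometryEquiv rfl

/-- `rot7Inv` acts as `rot7InvLin` (private plumbing). [folklore] -/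
private theorem rot7Inv_apply (v : Plane) : rot7Inv v = rot7InvLin v := rfl

/-- `ū (u ξ) = ξ`: the rotation `R = ū ·` maps the rotated lattice `u A₂` back onto `A₂`, label by
label (`R (rot7 k) = triPoint k`; private plumbing). [folklore] -/
private theorem rot7Inv_rot7 (k : ℤ × ℤ) : rot7Inv (rot7 k) = triPoint k := by
  have h3 : (√3 : ℝ) ^ 2 = 3 := Real.sq_sqrt (by norm_num)
  ext i
  fin_cases i
  · simp [rot7Inv_apply, rot7, sigma7Mul]
    linear_combination (9 * (k.1 : ℝ) / 196 - 15 * (k.2 : ℝ) / 196) * h3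
  · simp [rot7Inv_apply, rot7, sigma7Mul]
    ring

/-- **The `Σ7` competitor satisfies the corrected conclusion of Theorem 1.2**: its image `u A₂`
is a *rotated* copy of `A₂` — `R (u A₂) + 0 = A₂` for the rotation `R = ū ·` — although it is not
a translate of `A₂` (`range_rotated7_add_ne`). So the `L = 7` degeneracy of the printed statement
(`Theil2006_periodicGroundStates.no_groundState_seven`) does not carry over to the rotation form
`Theil2006_periodicGroundStates_upToRotation`. This is our proof of the instance `Ω = u A₂` of the
rigidity statement the proof of Theorem 1.2 rests on (§3, p. 13: every nonempty `Ω ⊂ ℝ²` with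
(42) `min_{y ≠ y'} |y - y'| ≥ 1` and (43) `#{y' ∈ Ω | |y - y'| ≤ 1} = 7` for all `y ∈ Ω` satisfies
`RΩ + τ = A₂` for a rotation `R ∈ SO(2)` and a translation `τ`).
[cite: Theil2006, §3 Proof of Theorem 1.2, (42)–(43) and «RΩ + τ = A₂» (preprint p. 13), instance Ω = u A₂] -/
theorem exists_rotation_range_rotated7 :
    ∃ (R : Plane ≃ₗᵢ[ℝ] Plane) (τ : Plane),
      Set.range (fun k => R (rotated7 k) + τ) = triangularLattice := by
  refine ⟨rot7Inv, 0, ?_⟩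
  ext v
  simp only [add_zero, rotated7, rot7Inv_rot7, Set.mem_range, triangularLattice]
  constructor
  · rintro ⟨k, rfl⟩
    exact ⟨sigma7Equiv k, rfl⟩
  · rintro ⟨k, rfl⟩
    exact ⟨sigma7Equiv.symm k, by rw [Equiv.apply_symm_apply]⟩

end Theil2006

/-- NAMED FACT — **Theil 2006, Theorem 1.2 (ground states with periodic boundary conditions),
with the conclusion its printed proof establishes: ground states are rigid motions of `A₂`.**
Hypotheses verbatim as in `Theil2006_periodicGroundStates` (Theorem 1.2 as printed: "There exists
a constant `α₀ ∈ (0, 1/3)` such that for every pair of numbers `α ∈ (0, α₀)`, `L ∈ ℕ`, every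
potential `V(·)` which satisfies the assumptions of Theorem 1.1 and every ground state
`y_min : A₂ → ℝ²` of `E_L^per({y}) := ∑_{x ∈ A₂ ∩ LU, x' ∈ A₂∖{x}} V(|y(x) - y(x')|)` subject to
`y ∈ Y_L^per := {y : A₂ → ℝ² | y(x) - y(x') = x - x' if x - x' ∈ L A₂}` …"). Conclusion in the
form reached by the proof (§3, p. 14 of the accepted preprint of 26 Aug 2005): "Hence, the set
`Ω = {y_min(x) | x ∈ A₂}` satisfies (42) and (43) and consequentially `RΩ + τ = A₂` for a rotation
`R ∈ SO(2)` and a translation `τ ∈ ℝ²`." The printed theorem's last step "By the periodicity of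
`y_min` we can choose `R = Id`" fails whenever `L` has a prime factor `≡ 1 (mod 3)` (coincidence
rotations; `Theil2006.exists_isPeriodic_seven_rotated`, `Theil2006_periodicGroundStates.no_groundState_seven`),
so THIS is the statement the paper proves and the translation-only `Theil2006_periodicGroundStates`
is its misstated printed form (`Theil2006_periodicGroundStates.upToRotation`: printed ⇒ this).
`R` ranges over the linear isometries of `ℝ²` (`O(2) ⊇ SO(2)`): formally weaker than the source,
and equivalent to it since `A₂` is invariant under the reflection `b₂ ↦ b₁ - b₂`. Stated for
`L ≥ 1` and real-valued (soft-core) `V`, like every fact of `Theil2006.lean`. Users take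
`(h : Theil2006_periodicGroundStates_upToRotation)`.
[cite: Theil2006, §1 Theorem 1.2 with §3 Proof of Theorem 1.2 («RΩ + τ = A₂ for a rotation R ∈ SO(2) and a translation τ ∈ ℝ²»; accepted preprint 26 Aug 2005, pp. 2–3, 13–14)] -/
def Theil2006_periodicGroundStates_upToRotation : Prop :=
  ∃ α₀ : ℝ, 0 < α₀ ∧ α₀ < 1 / 3 ∧ ∀ α : ℝ, 0 < α → α < α₀ → ∀ L : ℕ, 0 < L →
    ∀ V : ℝ → ℝ, IsAdmissible α V → ∀ y : ℤ × ℤ → Plane, IsPeriodic L y →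
      (∀ y' : ℤ × ℤ → Plane, IsPeriodic L y' → periodicEnergy V L y ≤ periodicEnergy V L y') →
        ∃ (R : Plane ≃ₗᵢ[ℝ] Plane) (τ : Plane),
          Set.range (fun k => R (y k) + τ) = triangularLattice

/-- The printed (translation-only) Theorem 1.2 implies the rotation form (`R = 1`): the corrected
fact is weaker than the misstated one, as it must be (our proof relating the two readings of the
same printed theorem). [cite: Theil2006, §1 Theorem 1.2 (printed conclusion ⇒ conclusion of its proof, §3 p. 14)] -/
theorem Theil2006_periodicGroundStates.upToRotation (h : Theil2006_periodicGroundStates) :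
    Theil2006_periodicGroundStates_upToRotation := by
  obtain ⟨α₀, hα₀, hα₀', hmain⟩ := h
  refine ⟨α₀, hα₀, hα₀', fun α hα hα' L hL V hV y hy hmin => ?_⟩
  obtain ⟨τ, hτ⟩ := hmain α hα hα' L hL V hV y hy hmin
  exact ⟨LinearIsometryEquiv.refl ℝ Plane, τ, by simpa using hτ⟩

end Literature.MathematicalPhysics.StatisticalMechanics

end
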